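import Literature.AlgebraicGeometry.Frobenioids.ArithmeticFrobenioidThm64iiiDegreeReading
import Literature.AlgebraicGeometry.Frobenioids.ArithmeticFrobenioidThm64iiArith
import Literature.AlgebraicGeometry.Frobenioids.ArithmeticRealificationCor411
import Literature.AlgebraicGeometry.Frobenioids.ArithmeticFrobenioidThm64iRatStdVariants
import Literature.AlgebraicGeometry.Frobenioids.ArithmeticRealificationFrobeniusTrivial
import HarnessLib

/-!
# Frobenioids I, Theorem 6.4 (iii) — the typed schema `Thm64iii` AT THE CONSTRUCTIONS for an ARBITRARY equivalence
# `Ψ^rlf` of THE realifications and an ARBITRARY `Ψ′` with comparison functors `u_i` (row «T64iii-ARBITRARY-Ψ′», KNIT,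
# modulo the transport-compatibility (G2))

Mochizuki, *The geometry of Frobenioids I: the general theory*, Kyushu J. Math. **62** (2008) 293–400, §6,
Thm. 6.4 (iii), kurims text pp. 114–115; proof p. 116 l. 4–16 ("assertion (iii) follows formally from assertion (ii),
by applying Lemma 6.5"). [cite: MochizukiFrdI2008, Thm. 6.4 (iii) p.114]

PROOF-ONLY knit (cell abc-iut, row «T64iii-ARBITRARY-Ψ′», L1-lead R129 (1): (G1) abc-iut-L1-d1 p428043 · (G2) abc-iut-L1-d2
· (G3) abc-iut-L1-d9 p436379 + p436882 · assembler abc-iut-L1-t3; 0 `def`, no instance, no notation, no named fact).  For an ARBITRARY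
equivalence `Ψrlf : C_{K₁/F₁}^rlf ⥲ C_{K₂/F₂}^rlf`, THE Cor. 4.11 data of `Ψrlf` and THE induced `picMap` (with
`Thm64ii`) are abc-iut-L6-t10's `ArithFrd.thm64ii_arith'`; Frobenius degrees are preserved (`arith_rlf_cor411iv`); the
image of the Frobenius-trivial object `(X₁, 0)` is Frobenius-trivial (abc-iut-L1-t3's `arithRealification_isFrobeniusTrivial_map`);
and abc-iut-L1-d9's `exists_placeMap_thm64iii_arith_of_classClause'` (p436882) closes the schema from the δ-clause of
`thm64ii_arith'` and the transport compatibility; this file binds everything except the SINGLE remaining input, stated as the hypothesis `hG2` (row (G2), abc-iut-L1-d2): the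
perfected transport `θ` at `A₁` (for `Ψ′`, e.g. abc-iut-L1-d1's `exists_perfectedDivisorTransport_pfUntr_at_arith Ψ′ A₁`)
and THE realified transport `E = (Ψ^rlf)^Φ` agree through `ι : Φ^pf ⊆ Φ^rlf` up to an isomorphism `γ` of the base —
for EVERY Cor. 4.11 datum of `Ψrlf` (so that it applies to the ∃-packaged one).  RESULT `Thm64iii_arith_general_of_transportCompat`:
`∃ picMap, Thm64ii R₁ R₂ Ψrlf picMap ∧ ∃ placeMap, (prime transport) ∧ ∀ deg, Thm64iii R₁ R₂ Ψrlf picMap deg u₁ u₂ Ψ′ A₁ placeMap`.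
Nothing here bears on, or takes a side on, [IUTchIII] Cor. 3.12; no statement of the paper is strengthened.
-/

noncomputable section

open scoped NNReal

namespace Literature.AlgebraicGeometry.Frobenioids

open CategoryTheory Opposite Function NumberField Literature.AnabelianGeometry.EtaleTheta

section General

variable {F₁ : Type} [Field F₁] [NumberField F₁] {K₁ : Type} [Field K₁] [Algebra F₁ K₁] [IsGalois F₁ K₁]
  {F₂ : Type} [Field F₂] [NumberField F₂] {K₂ : Type} [Field K₂] [Algebra F₂ K₂] [IsGalois F₂ K₂]
  (hΦ₁ : PreFrobenioid.IsPerfFactorialOn (arithDivisorFunctor F₁ K₁))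
  (hΦ₂ : PreFrobenioid.IsPerfFactorialOn (arithDivisorFunctor F₂ K₂))
  (Ψrlf : PreFrobenioid.rlf (ModelFrobenioid.toElem (arithDivisorFunctor F₁ K₁) (unitsFunctor F₁ K₁)
      (divNatTrans F₁ K₁)) hΦ₁ ≌
    PreFrobenioid.rlf (ModelFrobenioid.toElem (arithDivisorFunctor F₂ K₂) (unitsFunctor F₂ K₂)
      (divNatTrans F₂ K₂)) hΦ₂)
  {U₁ : Type} [Category.{0} U₁] {U₂ : Type} [Category.{0} U₂]
  (u₁ : U₁ ⥤ PreFrobenioid.rlf (ModelFrobenioid.toElem (arithDivisorFunctor F₁ K₁) (unitsFunctor F₁ K₁)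
    (divNatTrans F₁ K₁)) hΦ₁)
  (u₂ : U₂ ⥤ PreFrobenioid.rlf (ModelFrobenioid.toElem (arithDivisorFunctor F₂ K₂) (unitsFunctor F₂ K₂)
    (divNatTrans F₂ K₂)) hΦ₂)
  (Ψ' : U₁ ≌ U₂) (A₁ : U₁)
  (θ : Perfection (Multiplicative (EffArithDivisor ((arithRealification hΦ₁).ops.base.obj (u₁.obj A₁)).L)) ≃*
    Perfection (Multiplicative (EffArithDivisor
      ((arithRealification hΦ₂).ops.base.obj (u₂.obj (Ψ'.functor.obj A₁))).L)))

/-- **[FrdI] Theorem 6.4 (iii) AS TYPED (`Thm64iii`), AT THE CONSTRUCTIONS, for an ARBITRARY `Ψ^rlf` and an ARBITRARY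
`Ψ′` with comparison functors `u_i`, MODULO the transport compatibility (G2)** (`hG2`: for every Cor. 4.11 datum
`(Ψ^Base, E, η)` of `Ψrlf` with its `Div`-clause, the perfected transport `θ` at `A₁` and `E` agree through
`ι : Φ^pf ⊆ Φ^rlf` up to a base isomorphism `γ`): THE induced `picMap` satisfies `Thm64ii`, and at `A₁` there is THE
place bijection induced by `θ` for which `Thm64iii R₁ R₂ Ψrlf picMap deg u₁ u₂ Ψ′ A₁ placeMap` holds for every `deg`.
[cite: MochizukiFrdI2008, Thm. 6.4 (iii) p.114] -/
theorem Thm64iii_arith_general_of_transportCompat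
    (hG2 : ∀ (ΨBase : FinSubextCat F₁ K₁ ⥤ FinSubextCat F₂ K₂) [ΨBase.IsEquivalence]
      (E : PreFrobenioidData.DivisorMonoidIsoOverBase (arithRealification hΦ₁).ops (arithRealification hΦ₂).ops ΨBase)
      (η : Ψrlf.functor ⋙ (arithRealification hΦ₂).ops.base ≅ (arithRealification hΦ₁).ops.base ⋙ ΨBase),
      (∀ ⦃A B⦄ (φ : A ⟶ B), (arithRealification hΦ₂).ops.div (Ψrlf.functor.map φ) =
        (arithRealification hΦ₂).ops.pull (η.hom.app A)
          (E.iso ((arithRealification hΦ₁).ops.base.obj A) ((arithRealification hΦ₁).ops.div φ))) →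
      ∃ γ : (arithRealification hΦ₂).ops.base.obj (u₂.obj (Ψ'.functor.obj A₁)) ≅
          ΨBase.obj ((arithRealification hΦ₁).ops.base.obj (u₁.obj A₁)),
        ∀ x : Perfection (Multiplicative (EffArithDivisor ((arithRealification hΦ₁).ops.base.obj (u₁.obj A₁)).L)),
          (PreFrobenioid.IsPerfFactorialOn.op hΦ₂ (op ((arithRealification hΦ₂).ops.base.obj
              (u₂.obj (Ψ'.functor.obj A₁))))).toRealification (θ x) =
            (arithRealification hΦ₂).ops.pull γ.hom
              (E.iso ((arithRealification hΦ₁).ops.base.obj (u₁.obj A₁))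
                ((PreFrobenioid.IsPerfFactorialOn.op hΦ₁ (op ((arithRealification hΦ₁).ops.base.obj
                  (u₁.obj A₁)))).toRealification x))) :
    ∃ picMap : ∀ A, (arithRealification hΦ₁).Pic A ≃+ (arithRealification hΦ₂).Pic (Ψrlf.functor.obj A),
      Thm64ii (arithRealification hΦ₁) (arithRealification hΦ₂) Ψrlf picMap ∧
      ∃ placeMap : Places ((arithRealification hΦ₁).ops.base.obj (u₁.obj A₁)).L ≃
          Places ((arithRealification hΦ₂).ops.base.obj (u₂.obj (Ψ'.functor.obj A₁))).L,
        (∀ v, Primes.congr θ (Quotient.mk (primarySetoid _) ⟨_, EffArithDivisor.isPrimary_of_single _ v⟩) =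
          Quotient.mk (primarySetoid _) ⟨_, EffArithDivisor.isPrimary_of_single _ (placeMap v)⟩) ∧
        ∀ deg : ℝ, Thm64iii (arithRealification hΦ₁) (arithRealification hΦ₂) Ψrlf picMap deg u₁ u₂ Ψ' A₁ placeMap := by
  -- THE Cor. 4.11 data of `Ψrlf` and THE induced `picMap` (abc-iut-L6-t10)
  obtain ⟨ΨBase, hEq, η, E, picMap, -, hdiv, hT, -, hδ, -⟩ := ArithFrd.thm64ii_arith' hΦ₁ hΦ₂ Ψrlf
  haveI := hEq
  -- Frobenius degrees are preserved (Cor. 4.11 (iv) at the realifications)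
  obtain ⟨-, -, -, -, hdegFr, -, -⟩ := arith_rlf_cor411iv F₁ K₁ F₂ K₂ hΦ₁ hΦ₂ Ψrlf
    (arith_rlf_cor411Setting F₁ K₁ F₂ K₂ hΦ₁ hΦ₂ Ψrlf)
    (arith_rlf_isOfRationallyStandardType F₁ K₁) (arith_rlf_isOfRationallyStandardType F₂ K₂)
  -- the Div-clause in the `PreFrobenioidData` letter
  have hdiv' : ∀ ⦃A B⦄ (φ : A ⟶ B), (arithRealification hΦ₂).ops.div (Ψrlf.functor.map φ) =
      (arithRealification hΦ₂).ops.pull (η.hom.app A)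
        (E.iso ((arithRealification hΦ₁).ops.base.obj A) ((arithRealification hΦ₁).ops.div φ)) :=
    fun A B φ => hdiv φ
  -- the Frobenius-trivial object `(X₁, 0)` and its image
  have hA : (arithRealification hΦ₁).ops.IsFrobeniusTrivial
      (⟨(arithRealification hΦ₁).ops.base.obj (u₁.obj A₁), 1⟩ : PreFrobenioid.rlf
        (ModelFrobenioid.toElem (arithDivisorFunctor F₁ K₁) (unitsFunctor F₁ K₁) (divNatTrans F₁ K₁)) hΦ₁) :=
    arithRealification_isFrobeniusTrivial_zero hΦ₁ _
  have hA' : (arithRealification hΦ₂).ops.IsFrobeniusTrivial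
      (Ψrlf.functor.obj ⟨(arithRealification hΦ₁).ops.base.obj (u₁.obj A₁), 1⟩) :=
    arithRealification_isFrobeniusTrivial_map hΦ₁ hΦ₂ ΨBase E Ψrlf.functor η (fun A B φ => hdegFr φ) hdiv' hA
  -- (G2): `ι (θ x) = γ^* (E (ι x))` for THIS datum of `Ψrlf`
  obtain ⟨γ, hγ⟩ := hG2 ΨBase E η hdiv'
  -- abc-iut-L1-d9's knit-ready closer: `hpic` := the δ-clause of `thm64ii_arith'` at `A = (X₁, 0)`, `Y := Ψ^Base X₁`,
  -- `e := E.iso X₁`, `hG2'` := `hγ`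
  obtain ⟨placeMap, hθ, hall⟩ :=
    exists_placeMap_thm64iii_arith_of_classClause' hΦ₁ hΦ₂ Ψrlf picMap u₁ u₂ Ψ' A₁ θ hA'
      (ΨBase.obj ((arithRealification hΦ₁).ops.base.obj (u₁.obj A₁))) γ
      (E.iso ((arithRealification hΦ₁).ops.base.obj (u₁.obj A₁)))
      (fun x => hδ ⟨(arithRealification hΦ₁).ops.base.obj (u₁.obj A₁), 1⟩ hA' x) hγ
  exact ⟨picMap, hT, placeMap, hθ, hall⟩

end General

end Literature.AlgebraicGeometry.Frobenioids

end
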